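import Literature.Analysis.FluidPDE.VorticityEquation
import Literature.Analysis.FluidPDE.ClassicalSolutionCalculus
import Literature.Analysis.FluidPDE.AxisymmetricVorticityTransport
import Literature.Analysis.FluidPDE.LerayProfileCalculus
import Literature.Analysis.FluidPDE.SpaceTimeSliceCalculus
import HarnessLib

/-!
# Route CorkscrewDynamo · crux `CorkscrewProfile` (stmt-NavierStokesRegularity-11282) — stub S2
# `stub_vorticitySqTransport`: the transport identity of `|ω|²` for classical solutions on `(−∞, 0)`

Stub `stub_vorticitySqTransport` of line `registered` (skeleton v17, lead c7): the pure-calculus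
input of the STRETCHING NECESSITY block (maximum principle for `φ = |ω|²`, `ω = curl u`). For a
classical Navier–Stokes solution `(u, p)` (`ν = 1`, zero force) on the open time set `(−∞, 0)`,
`φ(t, x) = ‖curl u(t)(x)‖²` has `C²` slices, is jointly continuous on `(−∞, 0) × ℝ³`, and is
differentiable in time with
`∂ₜφ = Δφ − Dφ[u] + 2⟪ω, Du[ω]⟫ − 2‖Dω‖²_F`.

Proof. The vorticity equation `∂ₜω + (u·∇)ω = (ω·∇)u + Δω`
(`IsClassicalNSSolutionOn.vorticity_eq`, Majda–Bertozzi §2.4 Prop. 2.4 / eq. (2.110), on the open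
set `Iio 0`, where the one-sided time derivative is the two-sided one), the time-differentiability
of `s ↦ ω(s, x)` from the joint smoothness of the vorticity
(`IsSmoothSpaceTimeOn.isSmoothSpaceTimeOn_vorticity`, `.hasDerivWithinAt_timeDerivWithin`),
`∂ₜ‖ω‖² = 2⟪ω, ∂ₜω⟫` (`HasDerivAt.norm_sq`), `Δ‖ω‖² = 2⟪Δω, ω⟫ + 2‖Dω‖²_F`
(`laplacian_inner_self_eq`) and `D‖ω‖²[v] = 2⟪ω, Dω v⟫` (`fderiv_inner_self_apply`).
-/

noncomputable section

open MeasureTheory Set Function Filter Topology InnerProductSpace Metric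
open Literature.Analysis.FluidPDE
open scoped RealInnerProductSpace Laplacian ContDiff

namespace Summit.NavierStokesRegularity.NavierStokesRegularity.Theorems.CorkscrewProfile.Birth

set_option linter.dupNamespace false

/-- **Stub S2 `stub_vorticitySqTransport` — the transport identity of `|ω|²`** (line `registered`
of crux stmt-NavierStokesRegularity-11282). For a classical Navier–Stokes solution (`ν = 1`, zero
force) on `(−∞, 0)`, `φ(t, x) = ‖curl u(t)(x)‖²` has `C²` slices, is jointly continuous on
`(−∞,0) × ℝ³`, and is differentiable in time with
`∂ₜφ = Δφ − Dφ[u] + 2⟪ω, Du[ω]⟫ − 2‖Dω‖²_F`: pair the vorticity equation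
`∂ₜω + (u·∇)ω = (ω·∇)u + Δω` (`IsClassicalNSSolutionOn.vorticity_eq` on the open set `Iio 0`)
with `2ω`, and use `Δ‖ω‖² = 2⟪Δω, ω⟫ + 2‖Dω‖²_F` (`laplacian_inner_self_eq`),
`D‖ω‖²[v] = 2⟪ω, Dω v⟫` (`fderiv_inner_self_apply`) and the joint smoothness of the vorticity
(`IsSmoothSpaceTimeOn.isSmoothSpaceTimeOn_vorticity`).
[cite: MajdaBertozziCUP2002, §2.4 Prop. 2.4 eq. (2.110)] -/
theorem stub_vorticitySqTransport
    {u : ℝ → EuclideanSpace ℝ (Fin 3) → EuclideanSpace ℝ (Fin 3)} {p : ℝ → EuclideanSpace ℝ (Fin 3) → ℝ}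
    (hsol : IsClassicalNSSolutionOn (Set.Iio 0) 1 0 u p) :
    (∀ t < 0, ContDiff ℝ 2 (fun x => ‖curl (u t) x‖ ^ 2)) ∧
    ContinuousOn (Function.uncurry fun t x => ‖curl (u t) x‖ ^ 2) (Set.Iio 0 ×ˢ Set.univ) ∧
    ∀ t < 0, ∀ x : EuclideanSpace ℝ (Fin 3), HasDerivAt (fun s => ‖curl (u s) x‖ ^ 2)
      ((Δ (fun y => ‖curl (u t) y‖ ^ 2)) x - fderiv ℝ (fun y => ‖curl (u t) y‖ ^ 2) x (u t x)
        + 2 * ⟪curl (u t) x, fderiv ℝ (u t) x (curl (u t) x)⟫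
        - 2 * frobeniusNormSq (fderiv ℝ (curl (u t)) x)) t := by
  have hS : UniqueDiffOn ℝ (Set.Iio (0 : ℝ)) := isOpen_Iio.uniqueDiffOn
  have hcl : Set.Iio (0 : ℝ) ⊆ closure (interior (Set.Iio 0)) := by
    rw [interior_Iio]
    exact subset_closure
  -- the vorticity is jointly smooth on `(−∞, 0) × ℝ³`, with `C²` slices
  have hω : IsSmoothSpaceTimeOn (Set.Iio 0) (vorticity u) :=
    hsol.smooth_velocity.isSmoothSpaceTimeOn_vorticity hS
  have hω2 : ∀ t < (0 : ℝ), ContDiff ℝ 2 (curl (u t)) := fun t ht => by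
    have hU3 : ContDiff ℝ 3 (u t) :=
      (hsol.contDiff_velocity ht).of_le (WithTop.coe_le_coe.2 le_top)
    exact contDiff_curl (n := 2) (by exact_mod_cast hU3)
  refine ⟨fun t ht => (hω2 t ht).norm_sq ℝ, hω.continuousOn.norm.pow 2, fun t ht x => ?_⟩
  -- `s ↦ ω(s, x)` is differentiable at `t < 0` with derivative `∂ₜω(t, x)`
  have hd : HasDerivAt (fun s => curl (u s) x) (timeDerivWithin (Set.Iio 0) (vorticity u) t x) t :=
    (hω.hasDerivWithinAt_timeDerivWithin hS ht x).hasDerivAt (Iio_mem_nhds ht)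
  -- the vorticity equation `∂ₜω = (ω·∇)u + Δω − (u·∇)ω`
  have hveq := hsol.vorticity_eq hS hcl (fun _ _ y => curl_zero y) ht x
  rw [vorticity_apply, convect_apply, convect_apply, one_smul] at hveq
  have hD := eq_sub_of_add_eq hveq
  -- `∂ₜ‖ω‖² = 2⟪ω, ∂ₜω⟫`, then the two slice identities
  refine hd.norm_sq.congr_deriv ?_
  have hφ : (fun y => ‖curl (u t) y‖ ^ 2) = fun y => ⟪curl (u t) y, curl (u t) y⟫ := by
    funext y
    exact (real_inner_self_eq_norm_sq _).symm
  have hωd : DifferentiableAt ℝ (curl (u t)) x := ((hω2 t ht).differentiable (by simp)) x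
  rw [hD, hφ, laplacian_inner_self_eq (hω2 t ht) x, fderiv_inner_self_apply hωd (u t x),
    inner_sub_right, inner_add_right, real_inner_comm (curl (u t) x)]
  ring

end Summit.NavierStokesRegularity.NavierStokesRegularity.Theorems.CorkscrewProfile.Birth
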